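import Summits.QuantumFields.YangMills.Theorems.BalabanUVNodesN19LipschitzLinksTwoSidedLog
import Summits.QuantumFields.YangMills.Theorems.BalabanUVNodesN19C11LinkJacksonSmoothing

/-!
# YM-DAG node N19 (= NE7 proper) — `C²` LINKS OF THE ℓ¹-NORM ARE LOG-FREE
# (`dist_∞(h∘S_d, Π_t) ≤ 40·K·d∕t + 7.5·10⁸·κ·d²·log₂²t∕t² ≤ (40K + 3·10⁵κd)·d∕t` for `|h′| ≤ K`, `|h″| ≤ κ` on `[0, d]`, all `d`, `t ≥ 2^20`)

Cell `pub-ymgap`, HUMAN RULING D-0062 (Track A) ∕ D-0149, R141 (C) seat `pub-ymgap-dag-n19-e` (s3 = ALTERNATIVE CURRENCY), generation g35,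
module 4 (lineage module 188).  Route `Summits/QuantumFields/YangMills/Theses/BalabanUVNodes.lean`, cluster item K3⁸ «SpineGivenEndpointR13SepCoPHV»
(stmt-QuantumFields-27366); filed `--supports` that item `--as helper` (it proves no registered stub).  COUNT-NEUTRAL: [folklore]∕[bookkeeping] over the
lineage BY NAME — module 187 `…N19C11LinkJacksonSmoothing` (`exists_trigLink_near_C11Link_jackson`), module 176 (`exists_parameters_log`, `logb_le20`),
module 151 (`exists_mvPolynomial_near_trigLink_firstOrder`), PART 2 `…N19SingleModeL1Norm` (`exists_additiveJackson`), module 120 (`l1Norm_mem_Icc`),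
module 125 (`abs_integral_sub_integral_le_of_near`, `continuous_l1Norm`), module 134 (`exists_le_abs_l1Norm_sub_eval`), module 137
(`exists_laws_equalMixedMoments_l1Norm`); no laws of the scheme, no scheme object, no Theses import; NOT a discharge claim.

THE RESULT AND THE MECHANISM.  Module 176's budget (`L = ⌊t∕(5200log₂t)⌋`, `2π²L ≤ 2^J < 4π²L`, `h = ⌈3 log t⌉`, `N = ⌊3t∕8⌋`) is re-run VERBATIM with
module 187's SECOND-ORDER smoothing of a `C²` link in place of module 167's first-order one: the smoothing error `κd²π⁴∕(8L²)` and the second-order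
remainder `κ(dπ∕2^J)² ≤ κd²∕(4π²L²)` are now BOTH `≲ κd²log₂²t∕t²` (`1∕L ≤ 7800log₂t∕t`), the first-order terms `2K·dπ∕N + K·dπ∕N ≤ 12πKd∕t` and the
ladder `≤ Kd∕t` are log-free (§1 `errorBound_C11`).  ★★★ `exists_mvPolynomial_near_C11Link_l1Norm_of_le`: for `h` with `h′`, `h″` everywhere,
`|h′| ≤ K`, `|h″| ≤ κ` on `[0, d]` and `t ≥ 2^20`, a `P ∈ Π_t` with **`|h(Σ|x_i|) − P(x)| ≤ 40·K·d∕t + 7.5·10⁸·κ·d²·log₂²t∕t²`** on `[−1,1]^d`;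
★★★ `exists_mvPolynomial_near_C11Link_l1Norm`: `≤ (40K + 3·10⁵κd)·d∕t` (`log₂²t ≤ t∕2500` beyond `2^20`, §1 `logb_sq_le`).  In the normalised form
`h(s) = d·g(s∕d)`, `g ∈ C²[0,1]`: `≤ (40‖g′‖_∞ + 3·10⁵‖g″‖_∞)·d∕t` — NO LOGARITHM (modules 123∕124: `50·V·d·log₂t(log₂t + 19)∕t`; module 176 for
Lipschitz links: `75000·K·d·log₂t∕t`).  §3: the law-level face (laws agreeing on `Π_t`: `≤ 2×` the bound) and ★★★ `C11Links_twoSided` — with module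
134's witness for `h = id` (`K = 1`, `κ = 0`): **the `C²` row of the currency map is `Θ(d∕t)`, two-sided, log-free**.  READING (desk
`numerics/OPEN-PROBLEM.md`): the logarithm of the general Lipschitz row, if real, lives at the JUMPS of `h′` (the hinge `|S_d − c|`), nowhere else.

HONEST FRAMING (binding).  Elementary and [folklore]; ONE construction, constants astronomical (`L ≍ √t` would do; module 176's `L ≍ t∕log t` is kept to
reuse its bookkeeping); NO consumer in the DAG today; nothing of Bałaban's instantiated; NE7 NOT PRINTED, NOT proved; N19 NOT discharged; count-neutral.
One finite `T⁴` programme at fixed `ε`; nothing continuum ∕ `ℝ⁴` ∕ OS ∕ mass-gap ∕ Clay.  0 `def` ∕ 0 `sorry`.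
-/

noncomputable section

open Finset MeasureTheory
open scoped Real

namespace Summit.QuantumFields.YangMills.Theorems.BalabanUVNodesN19C11LinksDegreeBudget

open Summit.QuantumFields.YangMills.Theorems.BalabanUVNodesN19C11LinkJacksonSmoothing (exists_trigLink_near_C11Link_jackson)
open Summit.QuantumFields.YangMills.Theorems.BalabanUVNodesN19LipschitzLinksDegreeBudgetLog (exists_parameters_log logb_le20)
open Summit.QuantumFields.YangMills.Theorems.BalabanUVNodesN19SmoothLinkFirstOrder (exists_mvPolynomial_near_trigLink_firstOrder)
open Summit.QuantumFields.YangMills.Theorems.BalabanUVNodesN19SingleModeL1Norm (exists_additiveJackson)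
open Summit.QuantumFields.YangMills.Theorems.BalabanUVNodesN19OscillatingLinksMultiscale (l1Norm_mem_Icc)
open Summit.QuantumFields.YangMills.Theorems.BalabanUVNodesN19OscillatingLinksMomentDiscrepancy
  (abs_integral_sub_integral_le_of_near continuous_l1Norm)
open Summit.QuantumFields.YangMills.Theorems.BalabanUVNodesN19SingleModeLowerBound (exists_le_abs_l1Norm_sub_eval)
open Summit.QuantumFields.YangMills.Theorems.BalabanUVNodesN19KinkLowerBoundLawsCube (exists_laws_equalMixedMoments_l1Norm)

variable {ι : Type*} [Fintype ι]

/-! ## §1 Bookkeeping: `log₂²t ≤ t∕2500` beyond `2^20`, and the error budget [bookkeeping] -/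

/-- `log₂²t ≤ t∕2500` for `t ≥ 2^20` (`2^{Λ−20} ≥ (1 + (Λ − 20)log 2∕2)²`). [bookkeeping] -/
theorem logb_sq_le {t : ℕ} (ht : 2 ^ 20 ≤ t) : Real.logb 2 t ^ 2 ≤ t / 2500 := by
  obtain ⟨hΛ20, -⟩ := logb_le20 ht
  set Λ : ℝ := Real.logb 2 t with hΛ
  have ht0 : (0 : ℝ) < t := by exact_mod_cast (show 0 < t by omega)
  have htΛ : (t : ℝ) = (2 : ℝ) ^ Λ := by rw [hΛ, Real.rpow_logb two_pos (by norm_num) ht0]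
  have hsplit : (2 : ℝ) ^ Λ = 2 ^ (20 : ℝ) * 2 ^ (Λ - 20) := by
    rw [← Real.rpow_add two_pos]; ring_nf
  have h220 : (2 : ℝ) ^ (20 : ℝ) = 1048576 := by norm_num
  have hlog2 : 0.6931 ≤ Real.log 2 := by linarith [Real.log_two_gt_d9]
  set y : ℝ := (Λ - 20) * Real.log 2 / 2 with hy
  have hy0 : 0 ≤ y := by rw [hy]; have := Real.log_pos one_lt_two; positivity
  have hexp : (1 + y) ^ 2 ≤ (2 : ℝ) ^ (Λ - 20) := by
    rw [Real.rpow_def_of_pos two_pos, show Real.log 2 * (Λ - 20) = y + y by rw [hy]; ring, Real.exp_add, ← sq]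
    exact pow_le_pow_left₀ (by positivity) (by linarith [Real.add_one_le_exp y]) 2
  have hylow : 0.34655 * (Λ - 20) ≤ y := by
    rw [hy]; nlinarith [hlog2, hΛ20]
  rw [htΛ, hsplit, h220]
  nlinarith [hexp, hylow, hΛ20, hy0]

/-- THE ERROR BOOKKEEPING (module 176's parameters, module 187's second-order data): smoothing `κd²π⁴∕(8L²)` and second order `κd²π²∕M² ≤ κd²∕(4π²L²)`
are `≤ 7.5·10⁸κd²Λ²∕t²` (`1∕L ≤ 7800Λ∕t`); first order `2K·dπ∕N ≤ 8πKd∕t`, chord `K·dπ∕N ≤ 4πKd∕t`, ladder `≤ Kd∕t` (`104000L ≤ t`); total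
`≤ 40Kd∕t + 7.5·10⁸κd²Λ²∕t²`. [bookkeeping] -/
theorem errorBound_C11 {K κ d t Λ L M N ε : ℝ} (hK : 0 ≤ K) (hκ : 0 ≤ κ) (hd : 0 < d) (ht : 1048576 ≤ t) (hΛ : 20 ≤ Λ) (hL1 : 1 ≤ L)
    (hLt : 5200 * Λ * L ≤ t) (htL : t ≤ 7800 * Λ * L) (hM : 2 * L * π * π ≤ M) (hMN : M ≤ N) (hN4 : t / 4 ≤ N) (hε : ε ≤ 1 / (2 * t ^ 2)) :
    κ * d ^ 2 * π ^ 4 / (8 * L ^ 2) +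
      (κ * (d * π / M) ^ 2 + 2 * K * (d * π / N) +
        ε * (π ^ 4 * (K * d) * L / 2) * (1 + 2 * L * π / d * (d * π / M + d * π / N))) + K * (d * (π / N)) ≤
        40 * K * d / t + 750000000 * κ * d ^ 2 * Λ ^ 2 / t ^ 2 := by
  have hπlo : 3.14 < π := Real.pi_gt_d2
  have hπhi : π < 3.15 := Real.pi_lt_d2
  have hπ := Real.pi_pos
  have ht0 : 0 < t := by linarith
  have hL0 : 0 < L := by linarith
  have hM0 : 0 < M := lt_of_lt_of_le (by positivity) hM
  have hN0 : 0 < N := lt_of_lt_of_le hM0 hMN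
  have hKd : 0 ≤ K * d := mul_nonneg hK hd.le
  have hκd : 0 ≤ κ * d ^ 2 := by positivity
  have hΛ0 : 0 < Λ := by linarith
  -- `1/L ≤ 7800Λ/t`
  have hinvL : 1 / L ≤ 7800 * Λ / t := by
    rw [div_le_div_iff₀ hL0 ht0, one_mul]; exact htL
  have hinvL2 : 1 / L ^ 2 ≤ (7800 * Λ / t) ^ 2 := by
    rw [one_div, ← inv_pow, ← one_div]; exact pow_le_pow_left₀ (by positivity) hinvL 2
  -- smoothing
  have hπhi4 : π < 3.1416 := Real.pi_lt_d4
  have hπ2 : π ^ 2 < 3.1416 * 3.1416 := by rw [pow_two]; exact mul_lt_mul'' hπhi4 hπhi4 hπ.le hπ.le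
  have hπ4 : π ^ 4 ≤ 97.42 := by nlinarith only [hπ2, pow_pos hπ 2]
  have hT1 : κ * d ^ 2 * π ^ 4 / (8 * L ^ 2) ≤ 740879100 * κ * d ^ 2 * Λ ^ 2 / t ^ 2 := by
    have e : κ * d ^ 2 * π ^ 4 / (8 * L ^ 2) = κ * d ^ 2 * (π ^ 4 / 8) * (1 / L ^ 2) := by field_simp
    rw [e]
    calc κ * d ^ 2 * (π ^ 4 / 8) * (1 / L ^ 2) ≤ κ * d ^ 2 * (97.42 / 8) * (7800 * Λ / t) ^ 2 :=
          mul_le_mul (mul_le_mul_of_nonneg_left (by linarith only [hπ4]) hκd) hinvL2 (by positivity) (by positivity)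
      _ = 740879100 * κ * d ^ 2 * Λ ^ 2 / t ^ 2 := by field_simp; ring
  -- second order (`M ≥ 2π²L`)
  have hT2 : κ * (d * π / M) ^ 2 ≤ 1690000 * κ * d ^ 2 * Λ ^ 2 / t ^ 2 := by
    have hππlo : 9 < π ^ 2 := by nlinarith only [hπlo, hπ]
    have hM2 : (d * π / M) ^ 2 ≤ (d * π / (2 * L * π * π)) ^ 2 :=
      pow_le_pow_left₀ (by positivity) (div_le_div_of_nonneg_left (by positivity) (by positivity) hM) 2
    have e : (d * π / (2 * L * π * π)) ^ 2 = d ^ 2 / (4 * L ^ 2 * π ^ 2) := by field_simp; ring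
    have h9 : d ^ 2 / (4 * L ^ 2 * π ^ 2) ≤ d ^ 2 * (1 / (36 * L ^ 2)) := by
      rw [div_le_iff₀ (by positivity), show d ^ 2 * (1 / (36 * L ^ 2)) * (4 * L ^ 2 * π ^ 2) = d ^ 2 * (π ^ 2 / 9) by field_simp; ring]
      nlinarith only [hππlo, pow_pos hd 2]
    have h1 : (d * π / M) ^ 2 ≤ d ^ 2 * (1 / (36 * L ^ 2)) := (hM2.trans e.le).trans h9
    calc κ * (d * π / M) ^ 2 ≤ κ * (d ^ 2 * (1 / (36 * L ^ 2))) := mul_le_mul_of_nonneg_left h1 hκ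
      _ = κ * d ^ 2 / 36 * (1 / L ^ 2) := by ring
      _ ≤ κ * d ^ 2 / 36 * (7800 * Λ / t) ^ 2 := mul_le_mul_of_nonneg_left hinvL2 (by positivity)
      _ = 1690000 * κ * d ^ 2 * Λ ^ 2 / t ^ 2 := by field_simp; ring
  -- first order and chord
  have hdN : d * π / N ≤ 4 * π * d / t := by
    rw [div_le_div_iff₀ hN0 ht0]
    have e2 := mul_le_mul_of_nonneg_left hN4 (by positivity : (0 : ℝ) ≤ 4 * π * d)
    have e3 : 4 * π * d * (t / 4) = d * π * t := by ring
    linarith only [e2, e3]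
  have hT3 : 2 * K * (d * π / N) ≤ 8 * π * (K * d) / t := by
    calc 2 * K * (d * π / N) ≤ 2 * K * (4 * π * d / t) := mul_le_mul_of_nonneg_left hdN (by positivity)
      _ = 8 * π * (K * d) / t := by ring
  have hT5 : K * (d * (π / N)) ≤ 4 * π * (K * d) / t := by
    calc K * (d * (π / N)) = K * (d * π / N) := by ring
      _ ≤ K * (4 * π * d / t) := mul_le_mul_of_nonneg_left hdN hK
      _ = 4 * π * (K * d) / t := by ring
  -- ladder
  have hT4 : ε * (π ^ 4 * (K * d) * L / 2) * (1 + 2 * L * π / d * (d * π / M + d * π / N)) ≤ K * d / t := by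
    have h1 : 2 * L * π / d * (d * π / M) ≤ 1 := by
      rw [show 2 * L * π / d * (d * π / M) = 2 * L * π * π / M by field_simp, div_le_one hM0]; exact hM
    have h2 : 2 * L * π / d * (d * π / N) ≤ 1 := by
      rw [show 2 * L * π / d * (d * π / N) = 2 * L * π * π / N by field_simp, div_le_one hN0]; exact hM.trans hMN
    have h3 : 1 + 2 * L * π / d * (d * π / M + d * π / N) ≤ 3 := by rw [mul_add]; linarith only [h1, h2]
    have hW : π ^ 4 * (K * d) * L / 2 ≤ 49.25 * (K * d) * L := by
      rw [div_le_iff₀ (by norm_num : (0 : ℝ) < 2)]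
      have := mul_le_mul_of_nonneg_right hπ4 (by positivity : (0 : ℝ) ≤ K * d * L)
      have h0 : 0 ≤ K * d * L := by positivity
      nlinarith only [this, h0]
    have h03 : (0 : ℝ) ≤ 1 + 2 * L * π / d * (d * π / M + d * π / N) := by positivity
    have h4 : ε * (π ^ 4 * (K * d) * L / 2) * (1 + 2 * L * π / d * (d * π / M + d * π / N)) ≤
        (1 / (2 * t ^ 2)) * (49.25 * (K * d) * L) * 3 :=
      mul_le_mul (mul_le_mul hε hW (by positivity) (by positivity)) h3 h03 (by positivity)
    refine h4.trans ?_
    rw [show 1 / (2 * t ^ 2) * (49.25 * (K * d) * L) * 3 = 73.875 * K * d * L / t ^ 2 by field_simp; ring,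
      div_le_div_iff₀ (by positivity) ht0]
    have hLsmall : 104000 * L ≤ t := by nlinarith only [hLt, hΛ, hL0]
    have := mul_le_mul_of_nonneg_left hLsmall (by positivity : (0 : ℝ) ≤ K * d * t)
    nlinarith only [this, hKd, ht0, hL0]
  have hsum : 740879100 * κ * d ^ 2 * Λ ^ 2 / t ^ 2 + (1690000 * κ * d ^ 2 * Λ ^ 2 / t ^ 2 + 8 * π * (K * d) / t + K * d / t) +
      4 * π * (K * d) / t ≤ 40 * K * d / t + 750000000 * κ * d ^ 2 * Λ ^ 2 / t ^ 2 := by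
    have e1 : 8 * π * (K * d) / t + K * d / t + 4 * π * (K * d) / t ≤ 40 * K * d / t := by
      rw [← add_div, ← add_div]
      refine div_le_div_of_nonneg_right ?_ ht0.le
      nlinarith only [hπhi, hKd]
    have e2 : 740879100 * κ * d ^ 2 * Λ ^ 2 / t ^ 2 + 1690000 * κ * d ^ 2 * Λ ^ 2 / t ^ 2 ≤ 750000000 * κ * d ^ 2 * Λ ^ 2 / t ^ 2 := by
      rw [← add_div]
      exact div_le_div_of_nonneg_right (by nlinarith only [hκd, sq_nonneg Λ]) (by positivity)
    linarith only [e1, e2]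
  linarith only [hT1, hT2, hT3, hT4, hT5, hsum]

/-! ## §2 ★★★ `C²` links of the ℓ¹-norm are log-free [folklore] -/

variable [Nonempty ι]

/-- ★★★ **`C²` LINKS OF THE ℓ¹-NORM ARE LOG-FREE (budget `t ≥ 2^20`, two-term form).**  For finite nonempty `ι` (`d = |ι|`), `h : ℝ → ℝ` with
derivatives `h′`, `h″` everywhere, `|h′| ≤ K` and `|h″| ≤ κ` on `[0, d]`, and `t ≥ 2^20`, there is `P : MvPolynomial ι ℝ` of total degree `≤ t` with
`|h(Σ_i|x_i|) − P(x)| ≤ 40·K·d∕t + 7.5·10⁸·κ·d²·log₂²t∕t²` on `[−1,1]^ι` (module 176's parameters; module 187's second-order smoothing of the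
de-trended link; module 151's first-order law with `B₂ = κ`, `B₁ = 2K`; the chord `h(0) + λ·A_N` by PART 2's additive Jackson polynomial). [folklore] -/
theorem exists_mvPolynomial_near_C11Link_l1Norm_of_le {h h' h'' : ℝ → ℝ} (hh : ∀ s, HasDerivAt h (h' s) s) (hh' : ∀ s, HasDerivAt h' (h'' s) s)
    {K κ : ℝ} (hK : ∀ s ∈ Set.Icc (0 : ℝ) (Fintype.card ι), |h' s| ≤ K) (hκ : ∀ s ∈ Set.Icc (0 : ℝ) (Fintype.card ι), |h'' s| ≤ κ)
    {t : ℕ} (ht : 2 ^ 20 ≤ t) :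
    ∃ P : MvPolynomial ι ℝ, P.totalDegree ≤ t ∧
      ∀ x : ι → ℝ, (∀ i, x i ∈ Set.Icc (-1 : ℝ) 1) →
        |h (∑ i, |x i|) - MvPolynomial.eval x P| ≤
          40 * K * Fintype.card ι / t + 750000000 * κ * (Fintype.card ι : ℝ) ^ 2 * Real.logb 2 t ^ 2 / (t : ℝ) ^ 2 := by
  set d : ℝ := (Fintype.card ι : ℝ) with hdd
  have hd : 0 < d := by rw [hdd]; exact_mod_cast Fintype.card_pos
  have ht0 : (0 : ℝ) < t := by exact_mod_cast (show 0 < t by omega)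
  have htr : (1048576 : ℝ) ≤ t := by exact_mod_cast ht
  have h0mem : (0 : ℝ) ∈ Set.Icc (0 : ℝ) d := ⟨le_rfl, hd.le⟩
  have hK0 : 0 ≤ K := (abs_nonneg _).trans (hK 0 h0mem)
  have hκ0 : 0 ≤ κ := (abs_nonneg _).trans (hκ 0 h0mem)
  obtain ⟨hΛ20, hΛlin⟩ := logb_le20 ht
  obtain ⟨L, J, hh₀, N, hL1, htL, hLt, hh1, hJh, hexph, hJ1, hLππ, hNJ, _hM4, hN4, hdeg⟩ := exists_parameters_log ht
  have hLr : (1 : ℝ) ≤ L := by exact_mod_cast hL1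
  obtain ⟨α, β, ω, g, g₁, hω0, hωΩ, hW, hg, hg₁, hC11, hB1, hlam, herr⟩ := exists_trigLink_near_C11Link_jackson hd hh hh' hK hκ hL1
  have hΩ : (0 : ℝ) ≤ 2 * L * π / d := by positivity
  obtain ⟨P₀, hP₀deg, hP₀err⟩ := exists_mvPolynomial_near_trigLink_firstOrder (ι := ι)
    (((range L ×ˢ range L) ×ˢ (range L ×ˢ range L)) ×ˢ (Finset.univ : Finset Bool)) 0 α β ω
    (Ω := 2 * L * π / d) (W := π ^ 4 * (K * d) * L / 2) (B₁ := 2 * K) (B₂ := κ) hg hg₁ hΩ hω0 hωΩ hW hC11 hB1 J hh₀ N hh1 hJh hNJ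
  have hNpos : 0 < N := by
    have h1 : (0 : ℝ) < N := lt_of_lt_of_le (by positivity) hN4
    exact_mod_cast h1
  obtain ⟨A, hAdeg, hAerr⟩ := exists_additiveJackson (ι := ι) hNpos
  have h2N : 2 * N ≤ t := by
    have h1 : (2 : ℝ) * N ≤ t := by
      have h2 : 0 ≤ 2 * Real.exp 2 * (2 * L * π) * (1 / 2 + π + 3 * π * J) + 2 * hh₀ * (2 ^ (J + 1) - 1) := by
        have : (1 : ℝ) ≤ 2 ^ (J + 1) := one_le_pow₀ (by norm_num)
        have h3 : (0 : ℝ) ≤ 2 ^ (J + 1) - 1 := by linarith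
        positivity
      linarith only [hdeg, h2]
    exact_mod_cast h1
  refine ⟨MvPolynomial.C (h 0) + MvPolynomial.C ((h d - h 0) / d) * A + P₀, ?_, fun x hx => ?_⟩
  · -- degree
    have e : 2 * Real.exp 2 * (2 * L * π / d) * (Fintype.card ι : ℝ) * (1 / 2 + π + 3 * π * J) =
        2 * Real.exp 2 * (2 * L * π) * (1 / 2 + π + 3 * π * J) := by rw [← hdd]; field_simp
    rw [e] at hP₀deg
    have hP₀ : P₀.totalDegree ≤ t := Nat.cast_le.1 (hP₀deg.trans hdeg)
    refine (MvPolynomial.totalDegree_add _ _).trans (max_le ((MvPolynomial.totalDegree_add _ _).trans (max_le ?_ ?_)) hP₀)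
    · rw [MvPolynomial.totalDegree_C]; exact Nat.zero_le _
    · exact (MvPolynomial.totalDegree_mul _ _).trans (by rw [MvPolynomial.totalDegree_C, zero_add]; exact hAdeg.trans h2N)
  · have hS := l1Norm_mem_Icc x hx
    rw [← hdd] at hS hP₀err hAerr
    have h1 := herr (∑ i, |x i|) ⟨hS.1, hS.2⟩
    have h2 := hP₀err x hx
    have h3 := hAerr x hx
    -- the arithmetic
    have hε : 2 * ((J : ℝ) + 1) * Real.exp (-(hh₀ : ℝ)) ≤ 1 / (2 * t ^ 2) := by
      calc 2 * ((J : ℝ) + 1) * Real.exp (-(hh₀ : ℝ)) ≤ 2 * (t / 4) * (1 / t ^ 3) := by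
            have := mul_le_mul hJ1 hexph (Real.exp_pos _).le (by positivity)
            linarith only [this]
        _ = 1 / (2 * t ^ 2) := by field_simp; ring
    have hNJr : ((2 : ℝ) ^ J) ≤ N := by exact_mod_cast hNJ
    have key := errorBound_C11 (M := (2 : ℝ) ^ J) (ε := 2 * ((J : ℝ) + 1) * Real.exp (-(hh₀ : ℝ))) hK0 hκ0 hd htr hΛ20 hLr hLt htL
      hLππ hNJr hN4 hε
    have hchord : |(h d - h 0) / d * (∑ i, |x i|) - (h d - h 0) / d * MvPolynomial.eval x A| ≤ K * (d * (π / N)) := by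
      rw [← mul_sub, abs_mul]
      exact mul_le_mul hlam h3 (abs_nonneg _) hK0
    have hev : MvPolynomial.eval x (MvPolynomial.C (h 0) + MvPolynomial.C ((h d - h 0) / d) * A + P₀) =
        h 0 + (h d - h 0) / d * MvPolynomial.eval x A + MvPolynomial.eval x P₀ := by
      simp only [map_add, map_mul, MvPolynomial.eval_C]
    rw [hev]
    have esplit : h (∑ i, |x i|) - (h 0 + (h d - h 0) / d * MvPolynomial.eval x A + MvPolynomial.eval x P₀) =
        (h (∑ i, |x i|) - h 0 - (h d - h 0) / d * (∑ i, |x i|) - g (∑ i, |x i|)) +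
          ((h d - h 0) / d * (∑ i, |x i|) - (h d - h 0) / d * MvPolynomial.eval x A) + (g (∑ i, |x i|) - MvPolynomial.eval x P₀) := by ring
    rw [esplit]
    calc |(h (∑ i, |x i|) - h 0 - (h d - h 0) / d * (∑ i, |x i|) - g (∑ i, |x i|)) +
          ((h d - h 0) / d * (∑ i, |x i|) - (h d - h 0) / d * MvPolynomial.eval x A) + (g (∑ i, |x i|) - MvPolynomial.eval x P₀)|
        ≤ |h (∑ i, |x i|) - h 0 - (h d - h 0) / d * (∑ i, |x i|) - g (∑ i, |x i|)| +
          |(h d - h 0) / d * (∑ i, |x i|) - (h d - h 0) / d * MvPolynomial.eval x A| + |g (∑ i, |x i|) - MvPolynomial.eval x P₀| :=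
          (abs_add_le _ _).trans (add_le_add (abs_add_le _ _) le_rfl)
      _ ≤ κ * d ^ 2 * π ^ 4 / (8 * L ^ 2) + K * (d * (π / N)) +
          (κ * (d * π / 2 ^ J) ^ 2 + 2 * K * (d * π / N) +
            2 * ((J : ℝ) + 1) * Real.exp (-(hh₀ : ℝ)) * (π ^ 4 * (K * d) * L / 2) *
              (1 + 2 * L * π / d * (d * π / 2 ^ J + d * π / N))) := add_le_add (add_le_add h1 hchord) h2
      _ ≤ 40 * K * d / t + 750000000 * κ * d ^ 2 * Real.logb 2 t ^ 2 / t ^ 2 := by linarith only [key]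

/-- ★★★ **`C²` LINKS OF THE ℓ¹-NORM ARE LOG-FREE — ONE CONSTANT**: under the same hypotheses and `t ≥ 2^20`,
**`|h(Σ_i|x_i|) − P(x)| ≤ (40·K + 3·10⁵·κ·d)·d∕t`** (§1 `logb_sq_le`).  Normalised (`h(s) = d·g(s∕d)`, `K = ‖g′‖_∞`, `κd = ‖g″‖_∞`):
`≤ (40‖g′‖_∞ + 3·10⁵‖g″‖_∞)·d∕t` — the `C²` row of the currency map carries NO logarithm (module 176 for Lipschitz links: `75000·K·d·log₂t∕t`). [folklore] -/
theorem exists_mvPolynomial_near_C11Link_l1Norm {h h' h'' : ℝ → ℝ} (hh : ∀ s, HasDerivAt h (h' s) s) (hh' : ∀ s, HasDerivAt h' (h'' s) s)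
    {K κ : ℝ} (hK : ∀ s ∈ Set.Icc (0 : ℝ) (Fintype.card ι), |h' s| ≤ K) (hκ : ∀ s ∈ Set.Icc (0 : ℝ) (Fintype.card ι), |h'' s| ≤ κ)
    {t : ℕ} (ht : 2 ^ 20 ≤ t) :
    ∃ P : MvPolynomial ι ℝ, P.totalDegree ≤ t ∧
      ∀ x : ι → ℝ, (∀ i, x i ∈ Set.Icc (-1 : ℝ) 1) →
        |h (∑ i, |x i|) - MvPolynomial.eval x P| ≤ (40 * K + 300000 * κ * Fintype.card ι) * Fintype.card ι / t := by
  set d : ℝ := (Fintype.card ι : ℝ) with hdd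
  have hd : 0 < d := by rw [hdd]; exact_mod_cast Fintype.card_pos
  have ht0 : (0 : ℝ) < t := by exact_mod_cast (show 0 < t by omega)
  have hκ0 : 0 ≤ κ := (abs_nonneg _).trans (hκ 0 ⟨le_rfl, hd.le⟩)
  obtain ⟨P, hP, herr⟩ := exists_mvPolynomial_near_C11Link_l1Norm_of_le hh hh' hK hκ ht
  refine ⟨P, hP, fun x hx => (herr x hx).trans ?_⟩
  rw [← hdd]
  have hsq := logb_sq_le ht
  have h1 : 750000000 * κ * d ^ 2 * Real.logb 2 t ^ 2 / (t : ℝ) ^ 2 ≤ 300000 * κ * d * d / t := by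
    rw [div_le_div_iff₀ (by positivity) ht0]
    have := mul_le_mul_of_nonneg_left hsq (by positivity : (0 : ℝ) ≤ 750000000 * κ * d ^ 2 * t)
    nlinarith only [this, hκ0, hd, ht0]
  have e : (40 * K + 300000 * κ * d) * d / t = 40 * K * d / t + 300000 * κ * d * d / t := by ring
  rw [e]
  linarith only [h1]

/-! ## §3 ★★★ The `C²` row is `Θ(d∕t)`, two-sided, log-free; the law-level face [folklore] -/

/-- ★★ **LAWS AGREEING ON `Π_t` INTEGRATE EVERY `C²` LINK OF `Σ|x_i|` TO WITHIN `2·(40K + 3·10⁵κd)·d∕t`.**  `P, Q` probability laws on `ℝ^ι` carried by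
`[−1,1]^ι` with equal mixed moments of total degree `≤ t` (`t ≥ 2^20`); `h` with `h′`, `h″` everywhere, `h′` bounded on `ℝ` (for continuity), `|h′| ≤ K` and
`|h″| ≤ κ` on `[0, d]`. [folklore] -/
theorem abs_integral_C11Link_l1Norm_sub_le_of_moments {P Q : Measure (ι → ℝ)} [IsProbabilityMeasure P] [IsProbabilityMeasure Q]
    (hP : P (Set.pi Set.univ (fun _ : ι => Set.Icc (-1 : ℝ) 1))ᶜ = 0) (hQ : Q (Set.pi Set.univ (fun _ : ι => Set.Icc (-1 : ℝ) 1))ᶜ = 0)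
    {t : ℕ} (ht : 2 ^ 20 ≤ t) (hmom : ∀ j : ι → ℕ, ∑ i, j i ≤ t → ∫ x, ∏ i, x i ^ j i ∂P = ∫ x, ∏ i, x i ^ j i ∂Q)
    {h h' h'' : ℝ → ℝ} (hh : ∀ s, HasDerivAt h (h' s) s) (hh' : ∀ s, HasDerivAt h' (h'' s) s)
    {K κ : ℝ} (hK : ∀ s ∈ Set.Icc (0 : ℝ) (Fintype.card ι), |h' s| ≤ K) (hκ : ∀ s ∈ Set.Icc (0 : ℝ) (Fintype.card ι), |h'' s| ≤ κ) :
    |∫ x, h (∑ i, |x i|) ∂P - ∫ x, h (∑ i, |x i|) ∂Q| ≤ 2 * ((40 * K + 300000 * κ * Fintype.card ι) * Fintype.card ι / t) := by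
  obtain ⟨F, hF, happ⟩ := exists_mvPolynomial_near_C11Link_l1Norm (ι := ι) hh hh' hK hκ ht
  have hc : Continuous h := continuous_iff_continuousAt.2 fun s => (hh s).continuousAt
  exact abs_integral_sub_integral_le_of_near hP hQ hmom (hc.comp continuous_l1Norm) hF happ

/-- ★★★ **THE `C²` ROW OF THE CURRENCY MAP IS `Θ(d∕t)` — TWO-SIDED, LOG-FREE (both sides in one declaration).**  For finite nonempty `ι` (`d = |ι|`)
and `t ≥ 2^20`: (UPPER) every `h` with `h′`, `h″` everywhere, `|h′| ≤ K`, `|h″| ≤ κ` on `[0, d]` has `dist_∞(h∘S_d, Π_t) ≤ (40K + 3·10⁵κd)·d∕t`;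
(LOWER, module 134, the link `h = id`: `K = 1`, `κ = 0`) every `P ∈ Π_t` misses `S_d = Σ|x_i|` by `≥ d∕(π(9t+6))` somewhere on the cube; (LAWS)
the matching pair of module 137 with equal mixed moments of degree `≤ t` and `∫S_d dQ − ∫S_d dP ≥ 2d∕(π(9t+6))`. [folklore] -/
theorem C11Links_twoSided {t : ℕ} (ht : 2 ^ 20 ≤ t) :
    (∀ (K κ : ℝ) (h h' h'' : ℝ → ℝ), (∀ s, HasDerivAt h (h' s) s) → (∀ s, HasDerivAt h' (h'' s) s) →
      (∀ s ∈ Set.Icc (0 : ℝ) (Fintype.card ι), |h' s| ≤ K) → (∀ s ∈ Set.Icc (0 : ℝ) (Fintype.card ι), |h'' s| ≤ κ) →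
      ∃ P : MvPolynomial ι ℝ, P.totalDegree ≤ t ∧
        ∀ x : ι → ℝ, (∀ i, x i ∈ Set.Icc (-1 : ℝ) 1) →
          |h (∑ i, |x i|) - MvPolynomial.eval x P| ≤ (40 * K + 300000 * κ * Fintype.card ι) * Fintype.card ι / t) ∧
    (∀ P : MvPolynomial ι ℝ, P.totalDegree ≤ t →
      ∃ x : ι → ℝ, (∀ i, x i ∈ Set.Icc (-1 : ℝ) 1) ∧
        Fintype.card ι / (π * (9 * t + 6)) ≤ |(∑ i, |x i|) - MvPolynomial.eval x P|) ∧
    (∃ P Q : Measure (ι → ℝ), IsProbabilityMeasure P ∧ IsProbabilityMeasure Q ∧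
      P (Set.pi Set.univ (fun _ : ι => Set.Icc (-1 : ℝ) 1))ᶜ = 0 ∧ Q (Set.pi Set.univ (fun _ : ι => Set.Icc (-1 : ℝ) 1))ᶜ = 0 ∧
      (∀ j : ι → ℕ, ∑ i, j i ≤ t → ∫ x, ∏ i, x i ^ j i ∂P = ∫ x, ∏ i, x i ^ j i ∂Q) ∧
      2 * Fintype.card ι / (π * (9 * t + 6)) ≤ (∫ x, ∑ i, |x i| ∂Q) - ∫ x, ∑ i, |x i| ∂P) :=
  ⟨fun _ _ _ _ _ hh hh' hK hκ => exists_mvPolynomial_near_C11Link_l1Norm hh hh' hK hκ ht,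
    fun P hP => exists_le_abs_l1Norm_sub_eval (le_trans (by norm_num) ht) P hP,
    exists_laws_equalMixedMoments_l1Norm (le_trans (by norm_num) ht)⟩

end Summit.QuantumFields.YangMills.Theorems.BalabanUVNodesN19C11LinksDegreeBudget

end
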